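import Summits.HodgeConjecture.CorCM.HypLiu418.A3Liu418GSInstance
import Literature.NumberTheory.Automorphic.Liu2021.AppendixC.BettiH1Tower
import Literature.FieldTheory.AlgClosed.PadicAlgClEquivComplex
import HarnessLib

/-!
# FLOOR-0 P5, line `Cruxes/HLiu418/Lines/F0_AlbCm`: the registered stub `stub_S1_pinning : S1PinningShape` PROVED (by its exact text)

`S1PinningShape` (tree `Cruxes/HLiu418/Lines/F0_AlbCm.lean` :139–146, commit d37199775d9c) asks, for every record-curve datum
`(F, ι₁, J⋆, K₀, S, hU7ₛ, h4, isoₛ)`, for SOME Betti tower module `(H, rhoB)` with a Betti pinning of `sec42DataGS S h4 isoₛ` along `ι₁`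
for the translates `sec42HeckeTranslatesGS S hU7ₛ h4 isoₛ`.  The theorem below has THAT TYPE, token for token (the line is a crux
WORKFILE without an olean, so it is not imported; the line's edition then closes its stub by name, `:= stub_S1_pinning_holds`).
The witness is the DIRECT-LIMIT Betti tower of ★ `AppendixC/BettiH1Tower` (`Sec42Data.bettiH1Tower`, `HeckeTranslates.bettiHeckeRep`,
`bettiPinningOfTranslatesOfEtale`, p792869) at the ÉTALE injectivity ★ `hI_GS` (`CorCM/HypLiu418/A3Liu418GSInstance`, from
`albTransitionEpi_GS`) with `ℓ := 2` and an abstract field isomorphism `ι′ : ℂ ≃+* ℚ̄₂` (★ `Complex.nonempty_ringEquiv_padicAlgCl`).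
One theorem, no `sorry`.  HC_CM is proved only modulo the 7 printed citations until rung 0 closes; this closes ONE registered stub
of ONE floor-0 line.

References: [Liu2021] Y. Liu, Camb. J. Math. 9 (2021), §4.2 (FJcycle.tex l. 2077–2081: the Betti `H¹` of the Albanese tower as a
`G(𝔸^∞)`-module and its comparison with étale `H¹`).
-/

set_option autoImplicit false

-- the mandated namespace has the single-problem summit's repeated segment (`HodgeConjecture.HodgeConjecture`)
set_option linter.dupNamespace false

noncomputable section

namespace Summit.HodgeConjecture.HodgeConjecture.Cruxes.HLiu418.F0AlbCmStubS1Pinning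

open NumberField
open Literature.NumberTheory.Automorphic Literature.NumberTheory.Automorphic.UnitaryGroup
open Literature.NumberTheory.Automorphic.Liu2021.AppendixC
open Literature.AlgebraicGeometry.ShimuraVarieties.UnitaryCanonicalModel
open Summit.HodgeConjecture.CorCM (CMField)
open Summit.HodgeConjecture.CorCM.Lines.A3Liu418

/-- **`stub_S1_pinning` holds** — THE TYPE OF `S1PinningShape` (line `F0_AlbCm` :139–146), token for token: the record-curve Albanese
tower HAS a Betti pinning, namely the direct-limit Betti tower with the translates' action (★ `HeckeTranslates.nonempty_bettiPinning_of_injective`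
at `hI := hI_GS`, `ℓ := 2`, `ι′ : ℂ ≃+* ℚ̄₂`). [cite: Liu2021, §4.2 (FJcycle.tex l. 2079–2081)] -/
theorem stub_S1_pinning_holds :
    ∀ (F : CMField) (ι₁ : F →+* ℂ) (Jstar : Matrix (Fin 2) (Fin 2) (F : Type))
      (K₀ : C5.OpenCompactSubgroup ↥(finAdelic ↥(maximalRealSubfield (F : Type)) (F : Type) (IsCMField.complexConj (F : Type)) 2 Jstar))
      (S : RecordSystemGS (F : Type) Jstar ι₁ K₀) (hU7ₛ : S.HeckeTranslateDefinedOver)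
      (h4 : 4 ≤ Module.finrank ℚ (F : Type)) (isoₛ : ℕ → Prop),
      ∃ (H : Type) (_ : AddCommGroup H) (_ : Module ℂ H) (rhoB : Representation ℂ (sec42DataGS S h4 isoₛ).G H),
        Nonempty ((sec42DataGS S h4 isoₛ).BettiPinning (sec42HeckeTranslatesGS S hU7ₛ h4 isoₛ) ι₁ H rhoB) := by
  intro F ι₁ Jstar K₀ S hU7ₛ h4 isoₛ
  haveI : Fact (Nat.Prime 2) := ⟨Nat.prime_two⟩
  obtain ⟨ι'⟩ := Complex.nonempty_ringEquiv_padicAlgCl 2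
  exact ⟨_, inferInstance, inferInstance, _,
    (sec42HeckeTranslatesGS S hU7ₛ h4 isoₛ).nonempty_bettiPinning_of_injective ι₁ ι' (hI_GS S h4 isoₛ 2)⟩

end Summit.HodgeConjecture.HodgeConjecture.Cruxes.HLiu418.F0AlbCmStubS1Pinning

end
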